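import Literature.Analysis.FluidPDE.RusinSverakWeakStabilityProofs
import Literature.Analysis.FluidPDE.RusinSverakSingularPointProofs
import Literature.Analysis.FluidPDE.RusinSverakLerayWeakStrong
import Literature.Analysis.FluidPDE.RusinSverakKatoBoundHolds
import Literature.Analysis.FluidPDE.LerayFarFieldRegularity
import Literature.Analysis.FluidPDE.KatoLocalHolds
import HarnessLib

/-!
# Rusin–Šverák's weak-limit blow-up over the remaining local-Leray leaves

Analysis/FluidPDE proof file (no definitions, no named facts) for the named fact
`Literature.Analysis.FluidPDE.rusin_sverak_weak_limit_blowup` (`RusinSverakCompactnessProofs.lean`;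
W. Rusin, V. Šverák, *Minimal initial data for potential Navier–Stokes singularities*,
J. Funct. Anal. 260 (2011) 879–891 = arXiv:0911.0500, sentences 2–4 of the proof of **Cor. 4.3**,
p. 8: a bounded sequence of `Ḣ^{1/2}` blow-up data, normalised by scaling and translation so that
`T_max = 1` with a singular point at `(0, 1)`, has only blow-up data among the weak limits of its
subsequences — Cor. 4.2 applied after the paragraph following Thm. 4.1, "the only reason for
`T_max(u₀) < ∞` is a singularity at `t = T_max`").

The accepted reduction `rusin_sverak_weak_limit_blowup_of_singular_points'`
(`RusinSverakWeakStabilityProofs.lean`) derives the fact from the two PDE facts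
**N** = `rusin_sverak_singular_point_of_blowup` (finite `T_max` forces a singular point) and
**C** = `rusin_sverak_weak_limit_of_singular_points` (Cor. 4.2). Both are reduced further in the
tree: **N** by `rusin_sverak_singular_point_of_blowup_of_continuation : kato_local →
IsKatoSolutionOn.continuation_of_bounded → IsKatoSolutionOn.farField_bound → N`
(`RusinSverakSingularPoint.lean`), whose first two inputs are now theorems (`kato_local_holds`,
`KatoLocalHolds.lean`; `IsKatoSolutionOn.continuation_of_bounded_holds`,
`RusinSverakSingularPointProofs.lean`) and whose third is reduced to the local Leray theory by
`IsKatoSolutionOn.farField_bound_of_leray_theory : E → W → F → _` (`LerayFarFieldRegularity.lean`);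
**C** by `rusin_sverak_weak_limit_of_singular_points_of_leray_theory : E → W → R → S → C`
(`RusinSverakLeraySolutions.lean`) with **R** now a theorem (`kato_solution_le_div_sqrt_holds`,
`RusinSverakKatoBoundHolds.lean`) and **W** reduced by
`leray_solution_ae_eq_kato_of_local_leray_theory : U → A → W` (`RusinSverakLerayWeakStrong.lean`).

This file plugs the discharged theorems in and records the fact as a consequence of exactly the
named facts that are still undischarged (the same leaf sets as for Cor. 4.3 in
`RusinSverakCompactnessLeafAssembly.lean`):

* over **F′** = `IsKatoSolutionOn.farField_bound` and **C**
  (`rusin_sverak_weak_limit_blowup_of_farField_bound`);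
* over **E**, **W**, **F**, **S** (`rusin_sverak_weak_limit_blowup_of_leray_leaves`);
* over **E**, **U**, **A**, **F**, **S** (`rusin_sverak_weak_limit_blowup_of_local_leray_leaves`),

where **E** = `leray_solution_exists_of_memLp_three` (local Leray solutions exist for `L³` data),
**W** = `leray_solution_ae_eq_kato` (Rusin–Šverák Thm. 4.1), **U** =
`local_leray_weak_strong_uniqueness` (Lemarié-Rieusset Thm. 14.7), **A** =
`kato_isLocalLeraySolutionOn` (Lemarié-Rieusset Thm. 15.1 (A)), **F** =
`leray_solution_farField_bound` (far-field regularity of local Leray solutions), **S** =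
`rusin_sverak_leray_singular_points_stable` (Rusin–Šverák Thm. 4.2 with Lemma 2.1). The discharge
`rusin_sverak_weak_limit_blowup_holds` is the application of either of the last two theorems to
the `_holds` theorems of its leaves, once they exist.

## Mathlib / tree search

Tree only (Mathlib has no Navier–Stokes theory): `lean search 'rusin_sverak_weak_limit_blowup'`
gives the fact, `rusin_sverak_weak_limit_blowup_of_singular_points` (`N → C → Sobolev → _`,
`RusinSverakWeakStability.lean`), its primed form, the users
`rusin_sverak_minimal_data_compact_of_weak_limit_blowup`, `rusin_sverak_minimal_blowup_of_weak_limit_blowup`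
and `rusin_sverak_weak_limit_blowup_iff_unit_viscosity`; no assembly over the local-Leray leaves.

## References

* W. Rusin, V. Šverák, J. Funct. Anal. 260 (2011) 879–891 = arXiv:0911.0500, Thm. 4.1 (p. 6) and
  the paragraph following it, Thm. 4.2 (p. 7), Cor. 4.2, Cor. 4.3 and their proofs (p. 8).
  [RusinSverak2011]
* P. G. Lemarié-Rieusset, *The Navier–Stokes Problem in the 21st Century*, CRC Press 2016,
  doi:10.1201/b19556, Thm. 14.7, Thm. 15.1 (A)–(C) and proofs (PDF pp. 565–566).
  [LemarieRieusset2016]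
* T. Kato, Math. Z. 187 (1984) 471–480, Thm. 1. [Kato1984]
-/

noncomputable section

namespace Literature.Analysis.FluidPDE

/-- **Rusin–Šverák's weak-limit blow-up over the far-field bound and Cor. 4.2.** With Kato's
local existence theorem and the `L^∞` continuation of Kato solutions discharged, the fact
`rusin_sverak_weak_limit_blowup` follows from the far-field bound of Kato solutions
(**F′** = `IsKatoSolutionOn.farField_bound`, the remaining input of "finite `T_max` forces a
singular point") and Cor. 4.2 (**C**): `rusin_sverak_weak_limit_blowup_of_singular_points'` with
**N** from `rusin_sverak_singular_point_of_blowup_of_continuation`.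
[cite: RusinSverak2011, proof of Cor. 4.3, sentences 2–4 (arXiv:0911.0500 p. 8), with §4 p. 6] -/
theorem rusin_sverak_weak_limit_blowup_of_farField_bound (hF : IsKatoSolutionOn.farField_bound)
    (hC : rusin_sverak_weak_limit_of_singular_points) : rusin_sverak_weak_limit_blowup :=
  rusin_sverak_weak_limit_blowup_of_singular_points'
    (rusin_sverak_singular_point_of_blowup_of_continuation kato_local_holds
      IsKatoSolutionOn.continuation_of_bounded_holds hF) hC

/-- **Rusin–Šverák's weak-limit blow-up over E, W, F, S.** The fact
`rusin_sverak_weak_limit_blowup` follows from the existence of local Leray solutions for `L³`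
data (**E**), Rusin–Šverák's Thm. 4.1 (**W**), the far-field regularity of local Leray solutions
(**F**) and the stability of singular points Thm. 4.2 + Lemma 2.1 (**S**):
`rusin_sverak_weak_limit_blowup_of_farField_bound` with the far-field bound from
`IsKatoSolutionOn.farField_bound_of_leray_theory` and Cor. 4.2 from
`rusin_sverak_weak_limit_of_singular_points_of_leray_theory` with `kato_solution_le_div_sqrt_holds`.
[cite: RusinSverak2011, proof of Cor. 4.3, sentences 2–4 (arXiv:0911.0500 p. 8), with Cor. 4.2 and §4 p. 6] -/
theorem rusin_sverak_weak_limit_blowup_of_leray_leaves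
    (hE : leray_solution_exists_of_memLp_three) (hW : leray_solution_ae_eq_kato)
    (hF : leray_solution_farField_bound) (hS : rusin_sverak_leray_singular_points_stable) :
    rusin_sverak_weak_limit_blowup :=
  rusin_sverak_weak_limit_blowup_of_farField_bound
    (IsKatoSolutionOn.farField_bound_of_leray_theory hE hW hF)
    (rusin_sverak_weak_limit_of_singular_points_of_leray_theory hE hW
      kato_solution_le_div_sqrt_holds hS)

/-- **Rusin–Šverák's weak-limit blow-up over E, U, A, F, S**: as
`rusin_sverak_weak_limit_blowup_of_leray_leaves`, with Thm. 4.1 (**W**) supplied by the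
weak–strong uniqueness theorem for local Leray solutions (**U**, Lemarié-Rieusset Thm. 14.7) and
the local Leray property of Kato solutions (**A**, Thm. 15.1 (A)) through
`leray_solution_ae_eq_kato_of_local_leray_theory`.
[cite: RusinSverak2011, proof of Cor. 4.3, sentences 2–4 (arXiv:0911.0500 p. 8), with Cor. 4.2 and §4 p. 6] -/
theorem rusin_sverak_weak_limit_blowup_of_local_leray_leaves
    (hE : leray_solution_exists_of_memLp_three) (hU : local_leray_weak_strong_uniqueness)
    (hA : kato_isLocalLeraySolutionOn) (hF : leray_solution_farField_bound)
    (hS : rusin_sverak_leray_singular_points_stable) : rusin_sverak_weak_limit_blowup :=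
  rusin_sverak_weak_limit_blowup_of_leray_leaves hE
    (leray_solution_ae_eq_kato_of_local_leray_theory hU hA) hF hS

end Literature.Analysis.FluidPDE

end
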